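import Literature.MathematicalPhysics.QuantumLattice.FalicovKimballThermalChessboardGap
import Literature.MathematicalPhysics.QuantumLattice.BdGBondHamiltonianFreeEnergyBounds
import HarnessLib

/-!
# The Falicov–Kimball Hamiltonian on Fock space: partition function, effective potential, ground energy

Topic `Literature/MathematicalPhysics/QuantumLattice` (sub-namespace `FalicovKimball`, family
`hubbard`). Companion of `FalicovKimballChessboardBound.lean` (`h(s) = -K + uS`, `Tr|h|`),
`FalicovKimballChessboardGap.lean` (quantitative `T = 0` chessboard gap) and
`FalicovKimballThermalChessboardGap.lean` (`F_β(s) = -β⁻¹ Tr ln 2cosh(βh/2)`, quantitative `T > 0`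
chessboard gap). Those files work with the ONE-BODY matrix `h(s)`; this file identifies the two
functionals with the many-body objects of the spinless-fermion Falicov–Kimball Hamiltonian on the
tree's Jordan–Wigner Fock space `Fock ι = Finset ι → ℂ`,

  `H(s) = -Σ_{x,y} K_{xy} c†_x c_y + u Σ_x s_x (n_x - ½) = dΓ(h(s)) - (u/2)(Σ_x s_x)·1`

(Gruber–Macris 1996, eq. (2.5); Kennedy–Lieb 1986), for a FIXED classical configuration `s`:

* `partitionFn_fkHamiltonian` — `Tr e^{-βH(s)} = e^{βuΣs/2} Π_k (1 + e^{-βλ_k(h(s))})`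
  (the Fermi–Dirac grand-canonical partition function; GM (2.30) at `μ_e = μ_i = 0`, KL (13));
* `partitionFn_fkHamiltonian_eq_exp` — for hopping without on-site terms (`K_{xx} = 0`, e.g.
  bipartite `K`), **`Tr e^{-βH(s)} = e^{-β F_β(s)}`** with `F_β = fkEffPotential` (GM (2.27) with
  (2.31); KL (14)–(15)), and `fkEffPotential_eq_neg_log_re_partitionFn` — `F_β(s) = -β⁻¹ ln Tr e^{-βH(s)}`;
* `groundEnergy_fkHamiltonian` — **`E₀(H(s)) = -½ (Re Tr K + Tr|h(s)|)`**, i.e. `-½ Tr|h(s)|` without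
  on-site terms (GM (2.23) at `μ_e = μ_i = 0`, KL (10): fill the negative levels; obtained here by
  `β → ∞` in the two-sided bound `e^{-βE_qf} ≤ Tr e^{-βH} ≤ 2^{|Λ|} e^{-βE_qf}`);
* consequences on Fock space of the one-body chessboard theorems: the chessboard configurations
  minimise `E₀(H(s))` over `|s_x| ≤ 1` (`groundEnergy_fkHamiltonian_chessboard_le`, KL Theorem 1 /
  GM Theorem 4.1), with the quantitative gap `E₀(H(s)) - E₀(H(chessboard)) ≥ u²/(16(R+|u|)³) Σ_{x,y}
  |K_{xy}|²(s_x+s_y)²` for `s_x = ±1`, `‖K‖ ≤ R` (`groundEnergy_fkHamiltonian_chessboard_add_gap_le`),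
  uniquely so on a connected hopping graph (`groundEnergy_fkHamiltonian_eq_chessboard_iff`), and at
  `T > 0` the Boltzmann weights obey `Tr e^{-βH(s)} ≤ e^{-β·gap_β(s)} Tr e^{-βH(chessboard)}`
  (`re_partitionFn_fkHamiltonian_le_chessboard_mul_exp`).

One definition (`fkHamiltonian`, with body); everything else proved, no named facts.

## Mathlib / tree search

REUSED (tree): `dGamma`, `dGamma_add/smul/eq/diagonal`, `isHermitian_dGamma`, `numberAt`,
`partitionFn`, `gibbsWeight_add_smul_one`, `partitionFn_dGamma_eq_det'` (free-fermion trace formula),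
`det_one_add_exp_neg_smul_eq_ofReal`, `exp_le_re_det_one_add_exp_neg_smul`,
`re_det_one_add_exp_neg_smul_le`, `sum_min_eigenvalues_zero_eq`, `nonpos_of_forall_pos_mul_le`,
`exp_neg_mul_groundEnergy_le_partitionFn`, `partitionFn_le_card_mul_exp` (thermal sandwich),
`fkOneBody`, `traceAbs`, `traceAbs_eq_sum_abs_eigenvalues`, `re_trace_eq_sum_eigenvalues`,
`trace_eq_zero_of_bipartite`, `traceAbs_fkOneBody_le_chessboard`, `traceAbs_fkOneBody_chessboard`,
`traceAbs_fkOneBody_add_gap_le`, `traceAbs_fkOneBody_eq_chessboard_iff`, `fkEffPotential_eq_sum`,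
`exp_neg_mul_fkEffPotential_le`, `fkEffPotential_chessboard_le`. Nearest existing many-body
identification: `groundEnergy_bdgBondHamiltonian` (same `β → ∞` technique, BdG instead of FK).

## References

* C. Gruber, N. Macris, *The Falicov–Kimball model: a review of exact results and extensions*,
  Helv. Phys. Acta 69 (1996) 850–907, eqs. (2.4)–(2.5), (2.12)–(2.13), (2.22)–(2.23), (2.27),
  (2.30)–(2.31). [GruberMacris1996]
* T. Kennedy, E. H. Lieb, *A model for crystallization: a variation on the Hubbard model*, in:
  Statistical Mechanics and Field Theory (Groningen 1985), LNP 257, Springer 1986, pp. 1–9,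
  eqs. (10)–(15) and Theorem 1. [KennedyLieb1986LNP]
-/

noncomputable section

namespace Literature.MathematicalPhysics.QuantumLattice.FalicovKimball

open Matrix Complex Finset HubbardWave0 NormedSpace
open scoped ComplexOrder

variable {ι : Type*} [LinearOrder ι] [Fintype ι]

/-- The (spinless) **Falicov–Kimball Hamiltonian** in the classical configuration `s` on the
Jordan–Wigner Fock space: `H_Λ(s) = -Σ_{x,y} t_{xy} a†_x a_y + U Σ_x s_x (a†_x a_x - ½)`, i.e. the
second quantisation `dΓ(h(s))` of `h(s) = -T + US` shifted by the constant `-(U/2) Σ_x s_x`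
(hopping matrix `K = T`, coupling `u = U`). [cite: GruberMacris1996, eqs. (2.4)–(2.5)] -/
def fkHamiltonian (K : Matrix ι ι ℂ) (u : ℝ) (s : ι → ℝ) : Matrix (Finset ι) (Finset ι) ℂ :=
  dGamma (fkOneBody K u s) - (((u / 2 * ∑ x, s x : ℝ)) : ℂ) • (1 : Matrix (Finset ι) (Finset ι) ℂ)

section Basic

variable (K : Matrix ι ι ℂ) (u : ℝ) (s : ι → ℝ)

/-- `H(s)` written out as in the source: `-Σ_{x,y} K_{xy} c†_x c_y + u Σ_x s_x (n_x - ½)`.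
[cite: GruberMacris1996, eq. (2.5)] -/
theorem fkHamiltonian_eq_sum :
    fkHamiltonian K u s =
      -(∑ x, ∑ y, K x y • (creation x * annihilation y)) +
        ∑ x, ((u * s x : ℝ) : ℂ) • (numberAt x - (1 / 2 : ℂ) • (1 : Matrix (Finset ι) (Finset ι) ℂ)) := by
  have hneg : dGamma (-K) = -dGamma K := by
    rw [← neg_one_smul ℂ K, dGamma_smul, neg_one_smul]
  rw [fkHamiltonian, fkOneBody, dGamma_add, hneg, dGamma_eq K, dGamma_diagonal, add_sub_assoc]
  congr 1
  have hc : (((u / 2 * ∑ x, s x : ℝ)) : ℂ) • (1 : Matrix (Finset ι) (Finset ι) ℂ) =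
      ∑ x, ((u * s x : ℝ) : ℂ) • ((1 / 2 : ℂ) • (1 : Matrix (Finset ι) (Finset ι) ℂ)) := by
    rw [← Finset.sum_smul, smul_smul]
    congr 1
    push_cast
    rw [Finset.mul_sum, Finset.sum_mul]
    exact Finset.sum_congr rfl fun x _ => by ring
  rw [hc, ← Finset.sum_sub_distrib]
  exact Finset.sum_congr rfl fun x _ => (smul_sub _ _ _).symm

/-- `H(s) = dΓ(h(s)) + (-(u/2) Σ_x s_x)·1`. [cite: GruberMacris1996, eq. (2.5)] -/
theorem fkHamiltonian_eq_dGamma_add :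
    fkHamiltonian K u s =
      dGamma (fkOneBody K u s) + ((-(u / 2 * ∑ x, s x) : ℝ) : ℂ) • (1 : Matrix (Finset ι) (Finset ι) ℂ) := by
  rw [fkHamiltonian, sub_eq_add_neg, ← neg_smul, Complex.ofReal_neg]

/-- `H(s)` is Hermitian for Hermitian hopping. [cite: GruberMacris1996, eq. (2.5)] -/
theorem isHermitian_fkHamiltonian (hK : K.IsHermitian) : (fkHamiltonian K u s).IsHermitian := by
  have h1 : ((((u / 2 * ∑ x, s x : ℝ)) : ℂ) • (1 : Matrix (Finset ι) (Finset ι) ℂ)).IsHermitian := by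
    rw [IsHermitian, conjTranspose_smul, conjTranspose_one, Complex.star_def, Complex.conj_ofReal]
  exact (isHermitian_dGamma (isHermitian_fkOneBody K u s hK)).sub h1

end Basic

/-! ### The partition function and the effective potential -/

section Thermal

variable {K : Matrix ι ι ℂ}

/-- **Fermi–Dirac partition function in a fixed configuration**:
`Tr e^{-βH(s)} = e^{βuΣ_x s_x/2} Π_k (1 + e^{-βλ_k(h(s))})` (trace formula `Tr e^{-βdΓ(h)} =
det(1 + e^{-βh})` and the spectral theorem). [cite: GruberMacris1996, eq. (2.30) at `μ_e = μ_i = 0`][cite: KennedyLieb1986LNP, eq. (13)] -/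
theorem partitionFn_fkHamiltonian (hK : K.IsHermitian) (β u : ℝ) (s : ι → ℝ) :
    partitionFn β (fkHamiltonian K u s) =
      ((Real.exp (β * (u / 2 * ∑ x, s x)) *
        ∏ k, (1 + Real.exp (-β * (isHermitian_fkOneBody K u s hK).eigenvalues k)) : ℝ) : ℂ) := by
  have hh := isHermitian_fkOneBody K u s hK
  rw [fkHamiltonian_eq_dGamma_add, partitionFn, gibbsWeight_add_smul_one, trace_smul, smul_eq_mul,
    ← partitionFn, partitionFn_dGamma_eq_det' β hh, det_one_add_exp_neg_smul_eq_ofReal hh β,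
    show -(β : ℂ) * (((-(u / 2 * ∑ x, s x)) : ℝ) : ℂ) = ((β * (u / 2 * ∑ x, s x) : ℝ) : ℂ) by
      rw [Complex.ofReal_neg, mul_neg, neg_mul, neg_neg, ← Complex.ofReal_mul],
    ← Complex.ofReal_exp, ← Complex.ofReal_mul]

/-- The real part, factorised: `Re Tr e^{-βH(s)} = e^{βuΣs/2} · Re det(1 + e^{-βh(s)})`.
[cite: GruberMacris1996, eq. (2.30)] -/
theorem re_partitionFn_fkHamiltonian (hK : K.IsHermitian) (β u : ℝ) (s : ι → ℝ) :
    (partitionFn β (fkHamiltonian K u s)).re =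
      Real.exp (β * (u / 2 * ∑ x, s x)) * ((1 + exp (-(β : ℂ) • fkOneBody K u s)).det).re := by
  rw [partitionFn_fkHamiltonian hK, det_one_add_exp_neg_smul_eq_ofReal (isHermitian_fkOneBody K u s hK) β,
    Complex.ofReal_re, Complex.ofReal_re]

/-- `Tr e^{-βH(s)}` is a positive real number. [cite: GruberMacris1996, eq. (2.27)] -/
theorem re_partitionFn_fkHamiltonian_pos (hK : K.IsHermitian) (β u : ℝ) (s : ι → ℝ) :
    0 < (partitionFn β (fkHamiltonian K u s)).re := by
  rw [partitionFn_fkHamiltonian hK, Complex.ofReal_re]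
  exact mul_pos (Real.exp_pos _) (Finset.prod_pos fun k _ => by positivity)

/-- `Σ_k λ_k(h(s)) = Tr h(s) = -Re Tr K + u Σ_x s_x` ("`Tr h = U Σ s_x`" for hopping without
on-site terms). [cite: KennedyLieb1986LNP, text after eq. (10) and before eq. (14)] -/
theorem sum_eigenvalues_fkOneBody (hK : K.IsHermitian) (u : ℝ) (s : ι → ℝ) :
    ∑ k, (isHermitian_fkOneBody K u s hK).eigenvalues k = -(Matrix.trace K).re + u * ∑ x, s x := by
  rw [← re_trace_eq_sum_eigenvalues (isHermitian_fkOneBody K u s hK), fkOneBody, trace_add, trace_neg,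
    Complex.add_re, Complex.neg_re, trace_diagonal, Complex.re_sum, Finset.mul_sum]
  simp only [Complex.ofReal_re]

/-- **`e^{-βF_β(s)}` versus `Tr e^{-βH(s)}`, general hopping**: for `β ≠ 0`,
`e^{-β F_β(s)} = e^{-β Re Tr K / 2} · Tr e^{-βH(s)}` (`2cosh(βλ/2) = e^{βλ/2}(1 + e^{-βλ})` and
`Σ_k λ_k = -Tr K + uΣs`). [cite: GruberMacris1996, eqs. (2.30)–(2.31)][cite: KennedyLieb1986LNP, eqs. (13)–(15)] -/
theorem exp_neg_mul_fkEffPotential_eq (hK : K.IsHermitian) {β : ℝ} (hβ : β ≠ 0) (u : ℝ) (s : ι → ℝ) :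
    Real.exp (-(β * fkEffPotential β K u s)) =
      Real.exp (-(β / 2 * (Matrix.trace K).re)) * (partitionFn β (fkHamiltonian K u s)).re := by
  have hh := isHermitian_fkOneBody K u s hK
  set l : ι → ℝ := hh.eigenvalues with hl
  rw [fkEffPotential_eq_sum hK β u s, partitionFn_fkHamiltonian hK β u s, Complex.ofReal_re]
  have h1 : -(β * ∑ k, -(1 / β) * Real.log (2 * Real.cosh (β / 2 * l k))) =
      ∑ k, Real.log (2 * Real.cosh (β / 2 * l k)) := by
    rw [Finset.mul_sum, ← Finset.sum_neg_distrib]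
    refine Finset.sum_congr rfl fun k _ => ?_
    field_simp
  have h2 : ∀ k, Real.exp (Real.log (2 * Real.cosh (β / 2 * l k))) =
      Real.exp (β / 2 * l k) * (1 + Real.exp (-β * l k)) := fun k => by
    rw [Real.exp_log (by positivity), Real.cosh_eq, mul_add, mul_one, ← Real.exp_add,
      show β / 2 * l k + -β * l k = -(β / 2 * l k) by ring]
    ring
  have htr : (Matrix.trace K).re = u * ∑ x, s x - ∑ k, l k := by
    rw [hl, sum_eigenvalues_fkOneBody hK u s]; ring
  rw [h1, Real.exp_sum, Finset.prod_congr rfl fun k _ => h2 k, Finset.prod_mul_distrib,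
    ← Real.exp_sum, ← Finset.mul_sum, htr, ← mul_assoc, ← Real.exp_add]
  congr 2
  ring

/-- **`Tr e^{-βH(s)} = e^{-βF_β(s)}`** for hopping without on-site terms (`K_{xx} = 0`; e.g. any
bipartite `K`): the electronic trace in a fixed configuration is performed exactly and equals the
Boltzmann weight of the effective ("annealed") Ising interaction `F_β(s) = -β⁻¹ Tr ln(2cosh(βh(s)/2))`.
[cite: GruberMacris1996, eq. (2.27) with (2.31) at `μ_e = μ_i = 0`][cite: KennedyLieb1986LNP, eqs. (14)–(15)] -/
theorem partitionFn_fkHamiltonian_eq_exp (hK : K.IsHermitian) (hK0 : ∀ x, K x x = 0) {β : ℝ}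
    (hβ : β ≠ 0) (u : ℝ) (s : ι → ℝ) :
    partitionFn β (fkHamiltonian K u s) = ((Real.exp (-(β * fkEffPotential β K u s)) : ℝ) : ℂ) := by
  have htr : (Matrix.trace K).re = 0 := by
    rw [Matrix.trace, Complex.re_sum]
    exact Finset.sum_eq_zero fun x _ => by rw [Matrix.diag_apply, hK0 x, Complex.zero_re]
  have h := exp_neg_mul_fkEffPotential_eq hK hβ u s
  rw [htr, mul_zero, neg_zero, Real.exp_zero, one_mul] at h
  rw [h, partitionFn_fkHamiltonian hK β u s, Complex.ofReal_re]

omit [LinearOrder ι] [Fintype ι] in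
/-- Bipartite hopping has no on-site terms. [folklore] -/
private theorem apply_self_eq_zero_of_bipartite (p : ι → Bool) (hbip : ∀ x y, p x = p y → K x y = 0)
    (x : ι) : K x x = 0 :=
  hbip x x rfl

/-- **`F_β(s) = -β⁻¹ ln Tr e^{-βH(s)}`** (no on-site hopping terms, `β ≠ 0`): the effective
potential of the thermal files IS the free energy of the electrons in the configuration `s`.
[cite: GruberMacris1996, eq. (2.27) with (2.31) at `μ_e = μ_i = 0`] -/
theorem fkEffPotential_eq_neg_log_re_partitionFn (hK : K.IsHermitian) (hK0 : ∀ x, K x x = 0)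
    {β : ℝ} (hβ : β ≠ 0) (u : ℝ) (s : ι → ℝ) :
    fkEffPotential β K u s = -(1 / β) * Real.log (partitionFn β (fkHamiltonian K u s)).re := by
  rw [partitionFn_fkHamiltonian_eq_exp hK hK0 hβ u s, Complex.ofReal_re, Real.log_exp]
  field_simp

/-- **Chessboard domination of the Boltzmann weights, with the gap** (bipartite `K` with
`|λ_i(K)| ≤ R`, `s_x = ±1`, `β > 0`): `Tr e^{-βH(s)} ≤ e^{-β m_β u² Σ_{x,y}|K_{xy}|²(s_x+s_y)²/2} ·
Tr e^{-βH(chessboard)}`, `m_β = β³/(96 cosh⁴(1) max(1, β(R+|u|)/2)³)` — the many-body form of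
`fkEffPotential_chessboard_add_gap_le`. [cite: KennedyLieb1986LNP, eqs. (14)–(15) and Theorem 1][cite: GruberMacris1996, eq. (2.27) and Theorem 4.5] -/
theorem re_partitionFn_fkHamiltonian_le_chessboard_mul_exp (hK : K.IsHermitian) (p : ι → Bool)
    (hbip : ∀ x y, p x = p y → K x y = 0) {β : ℝ} (hβ : 0 < β) (u : ℝ) {s : ι → ℝ}
    (hs : ∀ x, s x = 1 ∨ s x = -1) {R : ℝ} (hR : ∀ i, |hK.eigenvalues i| ≤ R) (hρ : 0 < R + |u|) :
    (partitionFn β (fkHamiltonian K u s)).re ≤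
      (partitionFn β (fkHamiltonian K u (chessboard p))).re *
        Real.exp (-(β * (β ^ 3 / (96 * Real.cosh 1 ^ 4 * max 1 (β * (R + |u|) / 2) ^ 3) / 2 * u ^ 2 *
          ∑ x, ∑ y, ‖K x y‖ ^ 2 * (s x + s y) ^ 2))) := by
  have hK0 := apply_self_eq_zero_of_bipartite p hbip
  rw [partitionFn_fkHamiltonian_eq_exp hK hK0 hβ.ne' u s,
    partitionFn_fkHamiltonian_eq_exp hK hK0 hβ.ne' u (chessboard p), Complex.ofReal_re,
    Complex.ofReal_re]
  exact exp_neg_mul_fkEffPotential_le hK p hbip hβ u hs hR hρ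

/-- **The chessboard maximises the Boltzmann weight**: `Tr e^{-βH(s)} ≤ Tr e^{-βH(chessboard)}` for
bipartite `K`, `β > 0` and every `s_x = ±1`. [cite: KennedyLieb1986LNP, remark after eq. (15)][cite: GruberMacris1996, Theorem 4.5] -/
theorem re_partitionFn_fkHamiltonian_le_chessboard (hK : K.IsHermitian) (p : ι → Bool)
    (hbip : ∀ x y, p x = p y → K x y = 0) {β : ℝ} (hβ : 0 < β) (u : ℝ) {s : ι → ℝ}
    (hs : ∀ x, s x = 1 ∨ s x = -1) :
    (partitionFn β (fkHamiltonian K u s)).re ≤ (partitionFn β (fkHamiltonian K u (chessboard p))).re := by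
  have hK0 := apply_self_eq_zero_of_bipartite p hbip
  rw [partitionFn_fkHamiltonian_eq_exp hK hK0 hβ.ne' u s,
    partitionFn_fkHamiltonian_eq_exp hK hK0 hβ.ne' u (chessboard p), Complex.ofReal_re,
    Complex.ofReal_re, Real.exp_le_exp, neg_le_neg_iff]
  exact mul_le_mul_of_nonneg_left (fkEffPotential_chessboard_le hK p hbip hβ u hs) hβ.le

end Thermal

/-! ### The ground-state energy -/

section Ground

variable {K : Matrix ι ι ℂ}

/-- The quasi-free lower bound `e^{-βE_qf} ≤ Tr e^{-βH(s)}`, `E_qf = -½(Re Tr K + Tr|h(s)|)`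
(keep the filled Fermi sea: `Σ_{λ<0} λ = ½(Tr h - Tr|h|)`). [cite: GruberMacris1996, eqs. (2.12)–(2.13)] -/
theorem exp_le_re_partitionFn_fkHamiltonian (hK : K.IsHermitian) (β u : ℝ) (s : ι → ℝ) :
    Real.exp (-(β * (-(((Matrix.trace K).re + traceAbs (fkOneBody K u s)) / 2)))) ≤
      (partitionFn β (fkHamiltonian K u s)).re := by
  have hh := isHermitian_fkOneBody K u s hK
  have h1 := exp_le_re_det_one_add_exp_neg_smul hh β
  rw [sum_min_eigenvalues_zero_eq hh, re_trace_eq_sum_eigenvalues hh, sum_eigenvalues_fkOneBody hK u s,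
    ← traceAbs_eq_sum_abs_eigenvalues _ hh] at h1
  rw [re_partitionFn_fkHamiltonian hK β u s]
  have h2 : Real.exp (-(β * (-(((Matrix.trace K).re + traceAbs (fkOneBody K u s)) / 2)))) =
      Real.exp (β * (u / 2 * ∑ x, s x)) *
        Real.exp (-β * ((-(Matrix.trace K).re + u * ∑ x, s x - traceAbs (fkOneBody K u s)) / 2)) := by
    rw [← Real.exp_add]; congr 1; ring
  rw [h2]
  exact mul_le_mul_of_nonneg_left h1 (Real.exp_pos _).le

/-- The entropy upper bound `Tr e^{-βH(s)} ≤ 2^{|Λ|} e^{-βE_qf}` for `β ≥ 0`.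
[cite: GruberMacris1996, eqs. (2.12)–(2.13)] -/
theorem re_partitionFn_fkHamiltonian_le (hK : K.IsHermitian) {β : ℝ} (hβ : 0 ≤ β) (u : ℝ)
    (s : ι → ℝ) :
    (partitionFn β (fkHamiltonian K u s)).re ≤
      2 ^ Fintype.card ι * Real.exp (-(β * (-(((Matrix.trace K).re + traceAbs (fkOneBody K u s)) / 2)))) := by
  have hh := isHermitian_fkOneBody K u s hK
  have h1 := re_det_one_add_exp_neg_smul_le hh hβ
  rw [sum_min_eigenvalues_zero_eq hh, re_trace_eq_sum_eigenvalues hh, sum_eigenvalues_fkOneBody hK u s,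
    ← traceAbs_eq_sum_abs_eigenvalues _ hh] at h1
  rw [re_partitionFn_fkHamiltonian hK β u s]
  have h2 : Real.exp (-(β * (-(((Matrix.trace K).re + traceAbs (fkOneBody K u s)) / 2)))) =
      Real.exp (β * (u / 2 * ∑ x, s x)) *
        Real.exp (-β * ((-(Matrix.trace K).re + u * ∑ x, s x - traceAbs (fkOneBody K u s)) / 2)) := by
    rw [← Real.exp_add]; congr 1; ring
  rw [h2, mul_left_comm (2 ^ Fintype.card ι : ℝ) (Real.exp (β * (u / 2 * ∑ x, s x))) _]
  exact mul_le_mul_of_nonneg_left h1 (Real.exp_pos _).le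

/-- **The ground-state energy of the Falicov–Kimball Hamiltonian in a fixed configuration**
(all electron numbers, i.e. `μ_e = 0`): `E₀(H(s)) = -½ (Re Tr K + Tr|h(s)|)` — fill the negative
levels of `h(s)`, `Σ_{λ<0} λ = -½(Tr|h| - Tr h)`, `Tr h = -Tr K + uΣs`. Obtained by `β → ∞` in
`e^{-βE_qf} ≤ Tr e^{-βH} ≤ 2^{|Λ|}e^{-βE_qf}` against `e^{-βE₀} ≤ Tr e^{-βH} ≤ 2^{|Λ|}e^{-βE₀}`.
[cite: GruberMacris1996, eqs. (2.12)–(2.13) and (2.22)–(2.23)][cite: KennedyLieb1986LNP, eq. (10)] -/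
theorem groundEnergy_fkHamiltonian (hK : K.IsHermitian) (u : ℝ) (s : ι → ℝ) :
    (fkHamiltonian K u s).groundEnergy = -(((Matrix.trace K).re + traceAbs (fkOneBody K u s)) / 2) := by
  have hH : (fkHamiltonian K u s).IsHermitian := isHermitian_fkHamiltonian K u s hK
  set E : ℝ := -(((Matrix.trace K).re + traceAbs (fkOneBody K u s)) / 2) with hE
  have hD : (0 : ℝ) < Fintype.card (Finset ι) := by exact_mod_cast Fintype.card_pos
  have h1 : (fkHamiltonian K u s).groundEnergy - E ≤ 0 := by
    refine nonpos_of_forall_pos_mul_le (c := Real.log (Fintype.card (Finset ι))) ?_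
    intro β hβ
    have ha := exp_le_re_partitionFn_fkHamiltonian hK β u s
    rw [← hE] at ha
    have hb := partitionFn_le_card_mul_exp hH hβ.le
    have h := Real.log_le_log (Real.exp_pos _) (ha.trans hb)
    rw [Real.log_mul hD.ne' (Real.exp_pos _).ne', Real.log_exp, Real.log_exp] at h
    linarith
  have h2 : E - (fkHamiltonian K u s).groundEnergy ≤ 0 := by
    refine nonpos_of_forall_pos_mul_le (c := Real.log (2 ^ Fintype.card ι)) ?_
    intro β hβ
    have ha := exp_neg_mul_groundEnergy_le_partitionFn hH β
    have hb := re_partitionFn_fkHamiltonian_le hK hβ.le u s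
    rw [← hE] at hb
    have h4 : (0 : ℝ) < 2 ^ Fintype.card ι := by positivity
    have h := Real.log_le_log (Real.exp_pos _) (ha.trans hb)
    rw [Real.log_mul h4.ne' (Real.exp_pos _).ne', Real.log_exp, Real.log_exp] at h
    linarith
  linarith

/-- `H(s) ≥ E₀ = -½(Re Tr K + Tr|h(s)|)` as an operator inequality on Fock space.
[cite: GruberMacris1996, eq. (2.13)] -/
theorem posSemidef_fkHamiltonian_sub (hK : K.IsHermitian) (u : ℝ) (s : ι → ℝ) :
    (fkHamiltonian K u s - algebraMap ℝ (Matrix (Finset ι) (Finset ι) ℂ)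
      (-(((Matrix.trace K).re + traceAbs (fkOneBody K u s)) / 2))).PosSemidef := by
  rw [← groundEnergy_fkHamiltonian hK u s]
  exact posSemidef_sub_groundEnergy (isHermitian_fkHamiltonian K u s hK)

/-- Without on-site hopping terms (e.g. bipartite `K`): **`E₀(H(s)) = -½ Tr|h(s)|`**.
[cite: GruberMacris1996, eq. (2.23) at `μ_e = μ_i = 0`][cite: KennedyLieb1986LNP, eqs. (10)–(11)] -/
theorem groundEnergy_fkHamiltonian_of_apply_self_eq_zero (hK : K.IsHermitian) (hK0 : ∀ x, K x x = 0)
    (u : ℝ) (s : ι → ℝ) :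
    (fkHamiltonian K u s).groundEnergy = -(traceAbs (fkOneBody K u s)) / 2 := by
  have htr : (Matrix.trace K).re = 0 := by
    rw [Matrix.trace, Complex.re_sum]
    exact Finset.sum_eq_zero fun x _ => by rw [Matrix.diag_apply, hK0 x, Complex.zero_re]
  rw [groundEnergy_fkHamiltonian hK u s, htr, zero_add, neg_div]

/-- **The chessboard energy**: for bipartite `K`, `E₀(H(chessboard)) = -½ Σ_i √(λ_i(K)² + u²)`
(`(-K + uV)² = K² + u²`). [cite: KennedyLieb1986LNP, eqs. (11)–(12) (equality case)][cite: GruberMacris1996, Theorem 4.1] -/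
theorem groundEnergy_fkHamiltonian_chessboard (hK : K.IsHermitian) (p : ι → Bool)
    (hbip : ∀ x y, p x = p y → K x y = 0) (u : ℝ) :
    (fkHamiltonian K u (chessboard p)).groundEnergy = -(∑ i, Real.sqrt (hK.eigenvalues i ^ 2 + u ^ 2)) / 2 := by
  rw [groundEnergy_fkHamiltonian_of_apply_self_eq_zero hK (apply_self_eq_zero_of_bipartite p hbip),
    traceAbs_fkOneBody_chessboard hK p hbip u]

/-- **Kennedy–Lieb Theorem 1 on Fock space (all electron numbers)**: for bipartite `K` the
chessboard configuration minimises the ground-state energy of `H(s)` over all `|s_x| ≤ 1`: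
`E₀(H(chessboard)) ≤ E₀(H(s))`. [cite: KennedyLieb1986LNP, Theorem 1 and eqs. (10)–(12)][cite: GruberMacris1996, Theorem 4.1] -/
theorem groundEnergy_fkHamiltonian_chessboard_le (hK : K.IsHermitian) (p : ι → Bool)
    (hbip : ∀ x y, p x = p y → K x y = 0) (u : ℝ) {s : ι → ℝ} (hs : ∀ x, |s x| ≤ 1) :
    (fkHamiltonian K u (chessboard p)).groundEnergy ≤ (fkHamiltonian K u s).groundEnergy := by
  have hK0 := apply_self_eq_zero_of_bipartite p hbip
  rw [groundEnergy_fkHamiltonian_of_apply_self_eq_zero hK hK0,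
    groundEnergy_fkHamiltonian_of_apply_self_eq_zero hK hK0]
  have h := traceAbs_fkOneBody_le_chessboard hK p hbip u hs
  linarith

/-- **Quantitative chessboard gap for the many-body ground-state energy**: for bipartite `K` with
`|λ_i(K)| ≤ R`, `0 < R + |u|` and `s_x = ±1`,
`E₀(H(chessboard)) + u²/(16(R+|u|)³) Σ_{x,y} |K_{xy}|²(s_x+s_y)² ≤ E₀(H(s))` — every frustrated bond
(`s_x = s_y`, `K_{xy} ≠ 0`) raises the ground-state energy by at least `u²|K_{xy}|²/(4(R+|u|)³)`.
[cite: KennedyLieb1986LNP, Theorem 1 and eqs. (10)–(11) (concavity step made quantitative)] -/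
theorem groundEnergy_fkHamiltonian_chessboard_add_gap_le (hK : K.IsHermitian) (p : ι → Bool)
    (hbip : ∀ x y, p x = p y → K x y = 0) (u : ℝ) {s : ι → ℝ} (hs : ∀ x, s x = 1 ∨ s x = -1)
    {R : ℝ} (hR : ∀ i, |hK.eigenvalues i| ≤ R) (hρ : 0 < R + |u|) :
    (fkHamiltonian K u (chessboard p)).groundEnergy +
        u ^ 2 / (16 * (R + |u|) ^ 3) * ∑ x, ∑ y, ‖K x y‖ ^ 2 * (s x + s y) ^ 2 ≤
      (fkHamiltonian K u s).groundEnergy := by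
  rw [groundEnergy_fkHamiltonian_chessboard hK p hbip u,
    groundEnergy_fkHamiltonian_of_apply_self_eq_zero hK (apply_self_eq_zero_of_bipartite p hbip)]
  have h := traceAbs_fkOneBody_add_gap_le hK p hbip u hs hR hρ
  have h16 : u ^ 2 / (16 * (R + |u|) ^ 3) = u ^ 2 / (8 * (R + |u|) ^ 3) / 2 := by
    rw [div_div]; congr 1; ring
  rw [h16, div_mul_eq_mul_div]
  linarith

/-- **Uniqueness of the many-body minimiser**: for bipartite `K` whose hopping graph is connected,
`u ≠ 0` and `s_x = ±1`, `E₀(H(s)) = E₀(H(chessboard))` iff `s` is one of the two chessboard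
configurations. [cite: KennedyLieb1986LNP, Theorem 1][cite: GruberMacris1996, Theorem 4.1 (iii)] -/
theorem groundEnergy_fkHamiltonian_eq_chessboard_iff (hK : K.IsHermitian) (p : ι → Bool)
    (hbip : ∀ x y, p x = p y → K x y = 0)
    (hconn : ∀ x y, Relation.ReflTransGen (fun a b => K a b ≠ 0) x y)
    {u : ℝ} (hu : u ≠ 0) {s : ι → ℝ} (hs : ∀ x, s x = 1 ∨ s x = -1) :
    (fkHamiltonian K u s).groundEnergy = (fkHamiltonian K u (chessboard p)).groundEnergy ↔
      (s = chessboard p ∨ s = -chessboard p) := by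
  rw [← traceAbs_fkOneBody_eq_chessboard_iff hK p hbip hconn hu hs,
    groundEnergy_fkHamiltonian_chessboard hK p hbip u,
    groundEnergy_fkHamiltonian_of_apply_self_eq_zero hK (apply_self_eq_zero_of_bipartite p hbip)]
  constructor
  · intro h; linarith
  · intro h; rw [h]

end Ground

end Literature.MathematicalPhysics.QuantumLattice.FalicovKimball

end
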